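import Mathlib.Analysis.Calculus.IteratedDeriv.Lemmas
import Mathlib.Analysis.SpecialFunctions.ExpDeriv
import Mathlib.Analysis.SpecialFunctions.Trigonometric.Basic
import Mathlib.Topology.Algebra.Order.LiminfLimsup

/-!
# Crux `GreenKuboContinuation` (stmt-AtomisticToContinuum-12597), line `temperature-blind-vitali-hurwitz`:
# the `ν`-UNIFORMITY of the factorial constant and the corner SEED are load-bearing in `stub_realVitali`

Negative (tightness) lemmas of the drefute seat (gen 2) for the modulus of the picked line. The
landed consumer lemma `…Theorems.GreenKuboContinuation.TemperatureBlindVitaliHurwitz.stub_realVitali`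
(p72547) propagates the convergence of `g ν T` as `ν ↓ 0` from a corner `T ∈ (0, T₀)` to every
`T > 0` under (H1) smoothness of every `g ν` on `(0,∞)`, (H2) factorial bounds
`|∂_T^k g ν| ≤ C^{k+1} k!` (`k ≥ 1`) on compacts with a constant `C` UNIFORM IN `ν ∈ (0,1]`,
(H3) convergence on the corner. Known tightness: H1 cannot be dropped (gen-1 seat,
`DrefuteTightness.lean`: step-function junk `iteratedDeriv`), nor can the factorial RATE
(`Disproof.lean` §6 `corner_vanishing_not_smooth_rigid`: smooth bump). This file proves the two
remaining clauses are load-bearing as well: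

* `realVitali_false_without_uniformity` — with the quantifiers of H2 swapped to
  `∀ ν, ∃ C_ν` (each `g ν` real-analytic, even ENTIRE, but no common constant) the statement is
  FALSE: witness `g ν T := sin ν⁻¹ · e^{-2/ν} · e^{T/ν}`, `T₀ = 1` — it converges to `0` for every
  `T < 2` (so on the corner), equals `sin ν⁻¹` at `T = 2` (no limit), and
  `∂_T^k g ν = ν^{-k} g ν` is bounded on `[a,b]` by `C_ν^{k+1} k!` with `C_ν = max ν⁻¹ e^{b/ν}`.
  This is the "pinching" failure mode of `stub_logGevreyTower` in its purest form: no complex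
  singularity at all, only a constant of TYPE `1/ν`; hence the whole content of the tower is the
  `ν`-independence of `C`, not analyticity of each `T ↦ log A_T(ν)` (which is cheap for `ν > 0`).
* `realVitali_false_without_seed` — without H3 the statement is false (witness `g ν T := sin ν⁻¹`,
  all `T`-derivatives of order `≥ 1` vanish): the crux hypothesis, consumed as Vitali's seed, is
  indispensable (the modulus-side analogue of `Disproof.lean` §1 `not_continuesAlong_lt_one`).

Sorry-free; Mathlib only; axioms `propext`, `Classical.choice`, `Quot.sound`.
`not_tendsto_sin_inv` is taken verbatim from the gen-1 seat's `DrefuteTightness.lean`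
(refuter-drefute-stmt-AtomisticToContinuum-12597-0) so that this file is self-contained.
-/

noncomputable section

namespace Summit.AtomisticToContinuum.FouriersLaw.Theorems.GreenKuboContinuation.Negative

open Filter Topology Set

/-- `sin (ν⁻¹)` has no limit as `ν ↓ 0` (gen-1 drefute seat, `DrefuteTightness.lean`). -/
theorem not_tendsto_sin_inv :
    ¬ ∃ L : ℝ, Tendsto (fun ν : ℝ => Real.sin ν⁻¹) (𝓝[>] 0) (𝓝 L) := by
  rintro ⟨L, hL⟩
  have hlin : Tendsto (fun n : ℕ => (n : ℝ) * (2 * Real.pi)) atTop atTop :=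
    tendsto_natCast_atTop_atTop.atTop_mul_const (by positivity)
  have hu : Tendsto (fun n : ℕ => (Real.pi / 2 + n * (2 * Real.pi))⁻¹) atTop (𝓝[>] (0:ℝ)) := by
    refine tendsto_nhdsWithin_iff.2 ⟨?_, Eventually.of_forall fun n => ?_⟩
    · exact (tendsto_inv_atTop_zero : Tendsto (fun r : ℝ => r⁻¹) atTop (𝓝 0)).comp
        (tendsto_atTop_add_const_left atTop _ hlin)
    · exact mem_Ioi.2 (inv_pos.2 (by positivity))
  have hv : Tendsto (fun n : ℕ => (-(Real.pi / 2) + (n + 1 : ℕ) * (2 * Real.pi))⁻¹) atTop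
      (𝓝[>] (0:ℝ)) := by
    refine tendsto_nhdsWithin_iff.2 ⟨?_, Eventually.of_forall fun n => ?_⟩
    · refine (tendsto_inv_atTop_zero : Tendsto (fun r : ℝ => r⁻¹) atTop (𝓝 0)).comp
        (tendsto_atTop_add_const_left atTop _ ?_)
      exact hlin.comp (tendsto_add_atTop_nat 1)
    · have : (0:ℝ) < -(Real.pi / 2) + (n + 1 : ℕ) * (2 * Real.pi) := by
        have hn : (1:ℝ) ≤ ((n + 1 : ℕ) : ℝ) := by exact_mod_cast Nat.succ_le_succ (Nat.zero_le n)
        nlinarith [Real.pi_pos]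
      exact mem_Ioi.2 (inv_pos.2 this)
  have h1 : Tendsto (fun n : ℕ => Real.sin ((Real.pi / 2 + n * (2 * Real.pi))⁻¹)⁻¹) atTop (𝓝 L) :=
    hL.comp hu
  have h2 : Tendsto (fun n : ℕ => Real.sin ((-(Real.pi / 2) + (n + 1 : ℕ) * (2 * Real.pi))⁻¹)⁻¹)
      atTop (𝓝 L) := hL.comp hv
  simp only [inv_inv, Real.sin_add_nat_mul_two_pi, Real.sin_pi_div_two, Real.sin_neg] at h1 h2
  have e1 : L = 1 := tendsto_nhds_unique h1 tendsto_const_nhds |>.symm ▸ rfl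
  have e2 : (-1 : ℝ) = L := tendsto_nhds_unique tendsto_const_nhds h2
  linarith

/-! The pinching family `pinch ν T = sin ν⁻¹ · e^{-2/ν} · e^{T/ν}` (entire in `T` for each `ν`) is
written out explicitly below (no auxiliary `def`, so that this file is a pure proof file). -/

/-- Closed form of every `T`-derivative of the pinching family: `∂_T^k pinch ν = ν^{-k} pinch ν`. -/
theorem iteratedDeriv_pinch (ν : ℝ) (k : ℕ) :
    iteratedDeriv k (fun T : ℝ => (Real.sin ν⁻¹ * Real.exp (-(2 * ν⁻¹))) * Real.exp (ν⁻¹ * T)) =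
      fun T => (Real.sin ν⁻¹ * Real.exp (-(2 * ν⁻¹))) * ((ν⁻¹) ^ k * Real.exp (ν⁻¹ * T)) := by
  funext T
  have h : (fun T : ℝ => (Real.sin ν⁻¹ * Real.exp (-(2 * ν⁻¹))) * Real.exp (ν⁻¹ * T)) =
      fun T => (Real.sin ν⁻¹ * Real.exp (-(2 * ν⁻¹))) * (fun s => Real.exp (ν⁻¹ * s)) T := rfl
  rw [h, iteratedDeriv_const_mul_field, iteratedDeriv_exp_const_mul]

/-- Every `T`-derivative of the pinching family is differentiable (the family is entire in `T`). -/
theorem differentiable_iteratedDeriv_pinch (ν : ℝ) (k : ℕ) :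
    Differentiable ℝ (iteratedDeriv k
      (fun T : ℝ => (Real.sin ν⁻¹ * Real.exp (-(2 * ν⁻¹))) * Real.exp (ν⁻¹ * T))) := by
  rw [iteratedDeriv_pinch]
  fun_prop

/-- The `ν`-DEPENDENT factorial bound: on `[a,b]`, `|∂_T^k pinch ν| ≤ C_ν^{k+1} k!` with
`C_ν = max ν⁻¹ e^{b/ν}` (for `0 < ν ≤ 1`). -/
theorem abs_iteratedDeriv_pinch_le {ν a b : ℝ} (hν : 0 < ν) (hν1 : ν ≤ 1) (k : ℕ) {T : ℝ}
    (hT : T ∈ Icc a b) :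
    |iteratedDeriv k (fun T : ℝ => (Real.sin ν⁻¹ * Real.exp (-(2 * ν⁻¹))) * Real.exp (ν⁻¹ * T)) T| ≤
      (max ν⁻¹ (Real.exp (ν⁻¹ * b))) ^ (k + 1) * (k.factorial : ℝ) := by
  set C := max ν⁻¹ (Real.exp (ν⁻¹ * b)) with hC
  have hinv : 1 ≤ ν⁻¹ := one_le_inv_iff₀.2 ⟨hν, hν1⟩
  have hC1 : 1 ≤ C := hinv.trans (le_max_left _ _)
  have hC0 : 0 ≤ C := zero_le_one.trans hC1
  rw [iteratedDeriv_pinch]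
  simp only
  have h1 : |Real.sin ν⁻¹ * Real.exp (-(2 * ν⁻¹))| ≤ 1 := by
    rw [abs_mul, abs_of_pos (Real.exp_pos _)]
    have hs : |Real.sin ν⁻¹| ≤ 1 := Real.abs_sin_le_one _
    have he : Real.exp (-(2 * ν⁻¹)) ≤ 1 := by
      rw [Real.exp_le_one_iff]; nlinarith
    calc |Real.sin ν⁻¹| * Real.exp (-(2 * ν⁻¹)) ≤ 1 * 1 :=
          mul_le_mul hs he (Real.exp_pos _).le zero_le_one
      _ = 1 := one_mul _
  have h2 : |(ν⁻¹) ^ k * Real.exp (ν⁻¹ * T)| ≤ C ^ k * C := by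
    rw [abs_mul, abs_of_pos (pow_pos (inv_pos.2 hν) k), abs_of_pos (Real.exp_pos _)]
    refine mul_le_mul (pow_le_pow_left₀ (inv_pos.2 hν).le (le_max_left _ _) k) ?_
      (Real.exp_pos _).le (pow_nonneg hC0 k)
    exact (Real.exp_le_exp.2 (mul_le_mul_of_nonneg_left hT.2 (inv_pos.2 hν).le)).trans
      (le_max_right _ _)
  have hfact : (1 : ℝ) ≤ (k.factorial : ℝ) := by exact_mod_cast Nat.succ_le_of_lt k.factorial_pos
  calc |Real.sin ν⁻¹ * Real.exp (-(2 * ν⁻¹)) * ((ν⁻¹) ^ k * Real.exp (ν⁻¹ * T))|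
        = |Real.sin ν⁻¹ * Real.exp (-(2 * ν⁻¹))| * |(ν⁻¹) ^ k * Real.exp (ν⁻¹ * T)| := abs_mul _ _
    _ ≤ 1 * (C ^ k * C) := mul_le_mul h1 h2 (abs_nonneg _) zero_le_one
    _ = C ^ (k + 1) * 1 := by rw [one_mul, pow_succ, mul_one]
    _ ≤ C ^ (k + 1) * (k.factorial : ℝ) := mul_le_mul_of_nonneg_left hfact (pow_nonneg hC0 _)

/-- On `T < 2` the pinching family converges to `0` as `ν ↓ 0`. -/
theorem tendsto_pinch_of_lt_two {T : ℝ} (hT : T < 2) :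
    Tendsto (fun ν : ℝ => (Real.sin ν⁻¹ * Real.exp (-(2 * ν⁻¹))) * Real.exp (ν⁻¹ * T))
      (𝓝[>] 0) (𝓝 0) := by
  have hlin : Tendsto (fun ν : ℝ => ν⁻¹ * (2 - T)) (𝓝[>] (0:ℝ)) atTop :=
    tendsto_inv_nhdsGT_zero.atTop_mul_const (by linarith)
  have hexp : Tendsto (fun ν : ℝ => Real.exp (-(ν⁻¹ * (2 - T)))) (𝓝[>] (0:ℝ)) (𝓝 0) :=
    Real.tendsto_exp_neg_atTop_nhds_zero.comp hlin
  refine squeeze_zero_norm (fun ν => ?_) hexp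
  rw [Real.norm_eq_abs, abs_mul, abs_mul, abs_of_pos (Real.exp_pos _),
    abs_of_pos (Real.exp_pos _), mul_assoc, ← Real.exp_add]
  have he : Real.exp (-(2 * ν⁻¹) + ν⁻¹ * T) = Real.exp (-(ν⁻¹ * (2 - T))) := by
    congr 1; ring
  rw [he]
  calc |Real.sin ν⁻¹| * Real.exp (-(ν⁻¹ * (2 - T))) ≤ 1 * Real.exp (-(ν⁻¹ * (2 - T))) :=
        mul_le_mul_of_nonneg_right (Real.abs_sin_le_one _) (Real.exp_pos _).le
    _ = _ := one_mul _

/-- At `T = 2` the pinching family is `sin ν⁻¹`. -/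
theorem pinch_two (ν : ℝ) :
    (Real.sin ν⁻¹ * Real.exp (-(2 * ν⁻¹))) * Real.exp (ν⁻¹ * 2) = Real.sin ν⁻¹ := by
  rw [mul_assoc, ← Real.exp_add]
  have : -(2 * ν⁻¹) + ν⁻¹ * 2 = 0 := by ring
  rw [this, Real.exp_zero, mul_one]

/-- **`stub_realVitali` IS FALSE WITHOUT THE `ν`-UNIFORMITY OF ITS FACTORIAL CONSTANT** (any proof
must use that `C` in H2 does not depend on `ν`; equivalently, the content of `stub_logGevreyTower`
is the `ν`-independence of its constant): the statement with `∃ C, ∀ ν` weakened to `∀ ν, ∃ C` is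
refuted by the entire pinching family `pinch ν T = sin ν⁻¹ · e^{(T-2)/ν}`, `T₀ = 1`, at `T = 2`. -/
theorem realVitali_false_without_uniformity :
    ¬ (∀ (g : ℝ → ℝ → ℝ) (T₀ : ℝ), 0 < T₀ →
      (∀ ν : ℝ, 0 < ν → ν ≤ 1 → ∀ k : ℕ, DifferentiableOn ℝ (iteratedDeriv k (g ν)) (Set.Ioi 0)) →
      (∀ a b : ℝ, 0 < a → a < b → ∀ ν : ℝ, 0 < ν → ν ≤ 1 → ∃ C : ℝ, 0 < C ∧
        ∀ k : ℕ, 1 ≤ k → ∀ T ∈ Set.Icc a b,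
          |iteratedDeriv k (g ν) T| ≤ C ^ (k + 1) * (k.factorial : ℝ)) →
      (∀ T : ℝ, 0 < T → T < T₀ →
        ∃ L : ℝ, Filter.Tendsto (fun ν : ℝ => g ν T) (nhdsWithin (0:ℝ) (Set.Ioi 0)) (nhds L)) →
      ∀ T : ℝ, 0 < T →
        ∃ L : ℝ, Filter.Tendsto (fun ν : ℝ => g ν T) (nhdsWithin (0:ℝ) (Set.Ioi 0)) (nhds L)) := by
  intro h
  have hs : ∀ ν : ℝ, 0 < ν → ν ≤ 1 → ∀ k : ℕ,
      DifferentiableOn ℝ (iteratedDeriv k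
        (fun T : ℝ => (Real.sin ν⁻¹ * Real.exp (-(2 * ν⁻¹))) * Real.exp (ν⁻¹ * T))) (Set.Ioi 0) :=
    fun ν _ _ k => (differentiable_iteratedDeriv_pinch ν k).differentiableOn
  have hb : ∀ a b : ℝ, 0 < a → a < b → ∀ ν : ℝ, 0 < ν → ν ≤ 1 → ∃ C : ℝ, 0 < C ∧
      ∀ k : ℕ, 1 ≤ k → ∀ T ∈ Set.Icc a b,
        |iteratedDeriv k (fun T : ℝ => (Real.sin ν⁻¹ * Real.exp (-(2 * ν⁻¹))) *
          Real.exp (ν⁻¹ * T)) T| ≤ C ^ (k + 1) * (k.factorial : ℝ) := by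
    intro a b _ _ ν hν hν1
    refine ⟨max ν⁻¹ (Real.exp (ν⁻¹ * b)), lt_max_of_lt_left (inv_pos.2 hν), ?_⟩
    intro k _ T hT
    exact abs_iteratedDeriv_pinch_le hν hν1 k hT
  have hc : ∀ T : ℝ, 0 < T → T < 1 →
      ∃ L : ℝ, Tendsto (fun ν : ℝ => (Real.sin ν⁻¹ * Real.exp (-(2 * ν⁻¹))) *
        Real.exp (ν⁻¹ * T)) (𝓝[>] 0) (𝓝 L) :=
    fun T _ hT1 => ⟨0, tendsto_pinch_of_lt_two (by linarith)⟩
  obtain ⟨L, hL⟩ := h (fun ν T => (Real.sin ν⁻¹ * Real.exp (-(2 * ν⁻¹))) * Real.exp (ν⁻¹ * T))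
    1 one_pos hs hb hc 2 two_pos
  simp only [pinch_two] at hL
  exact not_tendsto_sin_inv ⟨L, hL⟩

/-- **`stub_realVitali` IS FALSE WITHOUT ITS SEED** (corner convergence): witness `g ν T := sin ν⁻¹`
(constant in `T`; every `T`-derivative of order `≥ 1` vanishes, so H1–H2 hold with `C = 1`). -/
theorem realVitali_false_without_seed :
    ¬ (∀ (g : ℝ → ℝ → ℝ),
      (∀ ν : ℝ, 0 < ν → ν ≤ 1 → ∀ k : ℕ, DifferentiableOn ℝ (iteratedDeriv k (g ν)) (Set.Ioi 0)) →
      (∀ a b : ℝ, 0 < a → a < b → ∃ C : ℝ, 0 < C ∧ ∀ ν : ℝ, 0 < ν → ν ≤ 1 →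
        ∀ k : ℕ, 1 ≤ k → ∀ T ∈ Set.Icc a b,
          |iteratedDeriv k (g ν) T| ≤ C ^ (k + 1) * (k.factorial : ℝ)) →
      ∀ T : ℝ, 0 < T →
        ∃ L : ℝ, Filter.Tendsto (fun ν : ℝ => g ν T) (nhdsWithin (0:ℝ) (Set.Ioi 0)) (nhds L)) := by
  intro h
  have hder : ∀ (ν : ℝ) (k : ℕ), 1 ≤ k →
      iteratedDeriv k (fun _ : ℝ => Real.sin ν⁻¹) = fun _ => 0 := by
    intro ν k hk
    funext x
    rw [iteratedDeriv_const]
    simp [Nat.one_le_iff_ne_zero.1 hk]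
  have hs : ∀ ν : ℝ, 0 < ν → ν ≤ 1 → ∀ k : ℕ,
      DifferentiableOn ℝ (iteratedDeriv k (fun _ : ℝ => Real.sin ν⁻¹)) (Set.Ioi 0) := by
    intro ν _ _ k
    rcases Nat.eq_zero_or_pos k with rfl | hk
    · simp only [iteratedDeriv_zero]; exact differentiableOn_const _
    · rw [hder ν k hk]; exact differentiableOn_const _
  have hb : ∀ a b : ℝ, 0 < a → a < b → ∃ C : ℝ, 0 < C ∧ ∀ ν : ℝ, 0 < ν → ν ≤ 1 →
      ∀ k : ℕ, 1 ≤ k → ∀ T ∈ Set.Icc a b,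
        |iteratedDeriv k (fun _ : ℝ => Real.sin ν⁻¹) T| ≤ C ^ (k + 1) * (k.factorial : ℝ) := by
    intro a b _ _
    refine ⟨1, one_pos, fun ν _ _ k hk T _ => ?_⟩
    rw [hder ν k hk]
    simp only [abs_zero, one_pow, one_mul]
    positivity
  obtain ⟨L, hL⟩ := h (fun ν _ => Real.sin ν⁻¹) hs hb 1 one_pos
  exact not_tendsto_sin_inv ⟨L, hL⟩

end Summit.AtomisticToContinuum.FouriersLaw.Theorems.GreenKuboContinuation.Negative

end
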